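import Summits.CriticalPhenomena.PercolationContinuityZ3.Theorems.PercNearOneGluingNoHeavyPcintClassCountLaw
import Summits.CriticalPhenomena.PercolationContinuityZ3.Theorems.PercNearOneGluingNoHeavyPcintMemoryTailLimit
import Summits.CriticalPhenomena.PercolationContinuityZ3.Theorems.PercNearOneGluingNoHeavyPcintHammersleyBound
import HarnessLib

/-!
# CriticalPhenomena/PercolationContinuityZ3 — Theorems/PercNearOneGluingNoHeavyPcintLoopExclusionLaw.lean: STRUCTURE CONJ **C4** of the pcint lane (the LOOP-EXCLUSION DECOMPOSITION of the memory tail), TYPED — with the PROVED identity `ln(μ_τ/μ) = Σ_{τ' > τ} Δ_{τ'}` linking it to the typed law C1′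

HONEST FRAMING: a law about HOW the finite-memory walk counts of the lane converge to the self-avoiding-walk connective
constant, rung by rung; a numerical law with a physical mechanism (hyperscaling), pre-registered and scored; NOT a theorem
and not used by any certified `p_c` cell.  Typed under the coordinator's STANDING RULE 2026-08-22 «NUMERICS ⇒ STRUCTURE ⇒
CONJECTURE» item (5) (a conjecture that survived ≥ 3 pre-registered predictions is typed as a Lean `Prop` with its evidence
ledger; the gate has no `Conjectures/` target under this summit, so the file sits with the lane's other typed laws
…PcintMemoryTailLaw (C1′), …PcintClassCountLaw (C3), …PcintSaturationLaw (C1b); namespace `…Theorems.Pcint.MemoryTail`).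
Statement of record: run/shared/lean/prim/pcint/STRUCTURE.md v0.6–v0.7 §2 (C4), §3 (P13, P15), §4 (N8); data table
run/shared/lean/prim/pcint/prim-pcint-2/gen15/first_order.out (prim-pcint-2 gen 15).

THE OBJECTS (all over the tree's memory-`τ` words, …PcintMemoryTailLaw / …PcintClassCountLaw):
* `μ_τ(d) = memGrowth d τ` (growth constant of memory-`τ` walks; `μ_τ ↓ μ(d)`, `tendsto_memGrowth`), and the RUNG COST
  **`Δ_τ(d) := ln(μ_{τ−2}(d)/μ_τ(d)) ≥ 0`** (`memLoopCost d τ`): the free energy per step of the loops newly forbidden when the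
  memory grows from `τ − 2` to `τ` (on the bipartite lattice these are the `τ`-step self-avoiding returns; odd memories add
  nothing);
* `2τ p_τ(ℤ^d) = closingCount d τ` = the number of `(τ−1)`-step self-avoiding words ending next to their start (= oriented rooted
  `τ`-step self-avoiding polygons opened at the root; the top census piece `nearWords d τ (τ−1)` of …PcintClassCountLaw);
* the FIRST-ORDER (independent-loop) density **`f_τ(d) := 2τ p_τ(ℤ^d) / μ_{τ−2}(d)^τ`** (`memLoopDensity d τ`): the density of
  `τ`-step return loops among memory-`(τ−2)` walks if the compatibility of the loop with the rest of the walk is ignored;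
* the COMPATIBILITY FACTOR **`R_τ(d) := Δ_τ(d) / f_τ(d)`** (`loopCompat d τ`), DEFINED by `Δ_τ = R_τ · 2τ p_τ μ_{τ−2}^{−τ}`.

THE LAW (C4).  (a) `0 < R_τ(d) < 1` for all `d ≥ 2`, even `τ ≥ 4` (`loopCompatWindow`); (b) `R_τ(d)` is strictly INCREASING in
`d` (`loopCompatStrictMonoDim`) and (c) strictly DECREASING in `τ` (`loopCompatStrictAntiMemory`); (d) **`R_τ(d) ≍ τ^{−max(α_d, 0)}`**
with `α_d = 2 − dν_d` the polygon (specific-heat) exponent: `√τ · R_τ(2) → c₂ > 0` (`loopCompatLawTwo`; `α₂ = 1/2`),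
`τ^{a} R_τ(3) → c₃ > 0` for an `a ∈ [0.15, 0.35]` (`loopCompatLawThree`; `α₃ = 2 − 3ν₃ ≈ 0.237`), `R_τ(4)` slowly varying
(`loopCompatLawFour`; `α₄ = 0`, logarithms), and `R_τ(d) → ρ_d ∈ (0, 1)` for `d ≥ 5` (`loopCompatLawHigh`; `α_d < 0`).
MECHANISM (hyperscaling + an `O(1)` compatibility cost per blob): `p_τ ≍ μ^τ τ^{α−3}` gives `f_τ ≍ τ^{α−2}`; the compatibility
of a `τ`-loop with the two arms costs a further factor `τ^{−α⁺}` (the arms must avoid the loop: a three-arm vertex), so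
`Δ_τ ≍ τ^{−2+α−α⁺}` and, summing the tail (`logRatio_eq_tsum_memLoopCost` below), `ln(μ_τ/μ) ≍ τ^{−(θ_d − 1)}` with
**`θ_d = dν_d + α_d⁺ = max(2, d/2)`** — which IS the exponent of the typed law C1′ (…PcintMemoryTailLaw: `lawLow` `θ = 2` for
`d = 2, 3`, `lawHigh` `θ = d/2` for `d ≥ 5`, `lawFour` marginal).  C4 is thus the rung-by-rung REFINEMENT of C1′: C1′ constrains
the tail sums, C4 the individual terms and their sign/ordering structure.

PROVED HERE (kernel-checked, no `sorry`, standard axioms): `Δ_τ ≥ 0` (`memLoopCost_nonneg`, from `memGrowth_antitone`);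
the rung costs TELESCOPE, `Σ_{m<M} Δ_{2m+4} = ln μ_2 − ln μ_{2M+2}` (`sum_memLoopCost`), are SUMMABLE with sum `ln(μ_2/μ)`
(`hasSum_memLoopCost`, from Madras–Slade Lemma 1.2.3 = `tendsto_memGrowth`), and **the quantity of C1′ is the tail sum of the
quantities of C4: `logRatio d (2M+2) = Σ_{m ≥ 0} Δ_{2(m+M)+4}(d)`** (`logRatio_eq_tsum_memLoopCost`); non-vacuity of the
denominator at EVERY rung of the law: `closingCount d (2m) > 0` for `d ≥ 2`, `m ≥ 2` (`closingCount_even_pos`, rectangles `1 × (m−1)`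
opened at the root; `exists_closingWord`) and `closingCount d (2k+1) = 0` (`closingCount_odd`: no odd polygons on the bipartite lattice).  NOT proved (and the first genuinely open clause): `Δ_τ > 0`,
i.e. STRICT monotonicity `μ_τ < μ_{τ−2}` of the memory hierarchy — a Kesten-pattern-type statement for finite-memory walks
(the tree's `SAW.Zd.thm723` is the `τ = ∞` analogue for self-avoiding walks); recorded as clause (a).

EVIDENCE LEDGER (gen15/first_order.py on the lane's growth constants gen12/DATA.txt — engine memmu.c, validated on every
printed value — and the polygon counts OEIS A002931 (`d = 2`), the lane's `p_n(ℤ³)` = Clisby–Liang–Slade 2007, CLS07 Tables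
A6–A8 (`d = 4, 5, 6`)); `R_τ(d)` for even `τ`:
 • `d = 2`, τ = 4..26: 0.586 0.426 0.355 0.311 0.281 0.257 0.239 0.224 0.211 0.200 0.191 0.183; `√τ R_τ = 0.903 + 0.81/τ ± 0.0013`
   over τ = 10..26 (0.984 / 0.972 / 0.962 / 0.954 / 0.949 / 0.944 / 0.940 / 0.936 / 0.934);
 • `d = 3`, τ = 4..18: 0.715 0.593 0.529 0.489 0.460 0.437 0.419 0.404; `τ^{0.237} R_τ = 0.751 + 0.92/τ ± 0.002` (τ = 10..18);
 • `d = 4`, τ = 4..16: 0.780 0.692 0.647 0.617 0.596 0.580 0.567 (local exponent 0.17 at τ = 16, falling);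
 • `d = 5`, τ = 4..14: 0.820 0.752 0.721 0.702 0.688 0.679 (local exponent 0.09);  `d = 6`, τ = 4..12: 0.848 0.792 0.769 0.757 0.749
   (local exponent 0.06) — every column in `(0,1)`, increasing in `d` at each `τ`, decreasing in `τ` at each `d`, flattening with `d`.
PRE-REGISTERED: P13 (2026-08-23T14:03Z, predictions/P13-loop-exclusion-compatibility-2026-08-23.md, sha256 b059ed42…, sealed before
the τ = 16 factors were computed): `R_16(5) ∈ [0.664, 0.678]` → 0.6710 HIT, `R_16(6) ∈ [0.737, 0.749]` → 0.7402 HIT, `R_14(6) ∈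
[0.741, 0.747]` → 0.7440 HIT (referee gen 90: consistency hits; P13c `μ_28(ℤ²)` standing); P15 (2026-08-24T07:38Z, sha256 1ff933dc…,
the SITE twin `R^N_τ(d)` of the neighbour-avoiding memory automaton with chordless neighbour-avoiding polygons, measured AFTER sealing
by kit j215057: `d = 6` τ-order `R^N_6 > R^N_8 > R^N_10 > R^N_12` = 0.631 > 0.555 > 0.520 > 0.502 HIT = clause (c) for the twin;
secondary fitted `d`-law bands MISS ×3 ⇒ negative N8, a statement about a fitted interpolation in `d`, not about C4).  The site twin
is not typed here (its growth constants live in …PcintNawMemoryTail; a sibling file can add it verbatim).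
SCOPE (honest): a METHOD-side law; nothing here is used by a certified cell.  Falsifiers (STRUCTURE §2): any `R_τ(d) ≥ 1` or
`≤ 0`; an inversion `R_τ(d+1) ≤ R_τ(d)` or `R_{τ+2}(d) ≥ R_τ(d)`; `√τ R_τ(2)` increasing at some τ ≥ 12 or leaving [0.85, 0.95] for τ ≤ 40.

Sources: N. Madras, G. Slade, The Self-Avoiding Walk (1993), §1.2 (memory-τ walks, Lemma 1.2.3) [MadrasSlade1993];
N. Clisby, R. Liang, G. Slade, Self-avoiding walk enumeration via the lace expansion, J. Phys. A 40 (2007) 10973 [ClisbyLiangSlade2007]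
(polygon counts, Tables A6–A8).  Written by prim-pcint-2 gen 16 (prover-prim-pcint-2-g16-0), 2026-08-24.
-/

noncomputable section

open Filter Topology
open Literature.Probability.LatticeModels Literature.Probability.Percolation
open Literature.Probability.RandomPlanarGeometry.SAW.Zd (connectiveConstant connectiveConstant_pos count)
open Summit.CriticalPhenomena.PercolationContinuityZ3.Theorems.Pcint

namespace Summit.CriticalPhenomena.PercolationContinuityZ3.Theorems.Pcint.MemoryTail

variable {d : ℕ}

/-! ### The objects -/

/-- **`2τ p_τ(ℤ^d)`**: the number of `(τ−1)`-step self-avoiding words on `ℤ^d` ending within `ℓ¹`-distance `1` of their start,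
i.e. of oriented rooted `τ`-step self-avoiding polygons opened at the root (the top census piece `nearWords d τ (τ−1)`).
[cite: MadrasSlade1993, §1.1 (polygons and self-avoiding returns) and §3.2] -/
def closingCount (d τ : ℕ) : ℕ := (nearWords d τ (τ - 1)).card

/-- **`Δ_τ(d) := ln(μ_{τ−2}(d)/μ_τ(d))`**, the rung cost of the memory hierarchy: the per-step free energy of the loops newly
forbidden when the memory grows from `τ − 2` to `τ`. [cite: MadrasSlade1993, §1.2, Lemma 1.2.3 (μ_τ decreasing in τ)] -/
def memLoopCost (d τ : ℕ) : ℝ := Real.log (memGrowth d (τ - 2) / memGrowth d τ)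

/-- **`f_τ(d) := 2τ p_τ(ℤ^d) / μ_{τ−2}(d)^τ`**, the first-order (independent-loop) density of `τ`-step return loops among
memory-`(τ−2)` walks.  STRUCTURE CONJ C4 object (prim-pcint-2 gen 15). [folklore] -/
def memLoopDensity (d τ : ℕ) : ℝ := (closingCount d τ : ℝ) / memGrowth d (τ - 2) ^ τ

/-- **`R_τ(d) := Δ_τ(d) / f_τ(d)`**, the loop-exclusion COMPATIBILITY FACTOR, defined by `Δ_τ = R_τ · 2τ p_τ μ_{τ−2}^{−τ}`.
STRUCTURE CONJ C4 object (prim-pcint-2 gen 15). [folklore] -/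
def loopCompat (d τ : ℕ) : ℝ := memLoopCost d τ / memLoopDensity d τ

/-! ### Proved bookkeeping: sign, telescoping, summability, and the link to C1′ -/

/-- `Δ_τ = ln μ_{τ−2} − ln μ_τ`. [cite: MadrasSlade1993, §1.2, Lemma 1.2.3] -/
theorem memLoopCost_eq [NeZero d] (τ : ℕ) :
    memLoopCost d τ = Real.log (memGrowth d (τ - 2)) - Real.log (memGrowth d τ) :=
  Real.log_div (memGrowth_pos (τ - 2)).ne' (memGrowth_pos τ).ne'

/-- **`Δ_τ(d) ≥ 0`**: the memory hierarchy is monotone (`μ_τ ≤ μ_{τ−2}`). [cite: MadrasSlade1993, §1.2, proof of Lemma 1.2.3] -/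
theorem memLoopCost_nonneg [NeZero d] (τ : ℕ) : 0 ≤ memLoopCost d τ :=
  Real.log_nonneg ((one_le_div (memGrowth_pos τ)).2 (memGrowth_antitone (by omega) d))

/-- `f_τ(d) ≥ 0`. [folklore] -/
theorem memLoopDensity_nonneg (d τ : ℕ) : 0 ≤ memLoopDensity d τ :=
  div_nonneg (Nat.cast_nonneg _) (pow_nonneg (memGrowth_nonneg d _) _)

/-- `f_τ(d) > 0` as soon as a closing word exists (`d ≥ 1`). [folklore] -/
theorem memLoopDensity_pos [NeZero d] {τ : ℕ} (h : 0 < closingCount d τ) : 0 < memLoopDensity d τ :=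
  div_pos (by exact_mod_cast h) (pow_pos (memGrowth_pos _) _)

/-- `R_τ(d) ≥ 0` (so clause (a) of C4 is about STRICT positivity and the upper bound `1`). [folklore] -/
theorem loopCompat_nonneg [NeZero d] (τ : ℕ) : 0 ≤ loopCompat d τ :=
  div_nonneg (memLoopCost_nonneg τ) (memLoopDensity_nonneg d τ)

/-- **The rung costs telescope**: `Σ_{m<M} Δ_{2m+4}(d) = ln μ_2(d) − ln μ_{2M+2}(d)`. [cite: MadrasSlade1993, §1.2, Lemma 1.2.3] -/
theorem sum_memLoopCost [NeZero d] (M : ℕ) :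
    ∑ m ∈ Finset.range M, memLoopCost d (2 * m + 4) =
      Real.log (memGrowth d 2) - Real.log (memGrowth d (2 * M + 2)) := by
  induction M with
  | zero => simp
  | succ M ih =>
    rw [Finset.sum_range_succ, ih, memLoopCost_eq, show 2 * M + 4 - 2 = 2 * M + 2 by omega,
      show 2 * (M + 1) + 2 = 2 * M + 4 by ring]
    ring

/-- The partial sums of the rung costs converge to the whole memory gap `ln(μ_2(d)/μ(d))` (Madras–Slade Lemma 1.2.3:
`μ_τ → μ`). [cite: MadrasSlade1993, §1.2, Lemma 1.2.3] -/
theorem tendsto_sum_memLoopCost [NeZero d] :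
    Tendsto (fun M : ℕ => ∑ m ∈ Finset.range M, memLoopCost d (2 * m + 4)) atTop
      (𝓝 (Real.log (memGrowth d 2 / connectiveConstant d))) := by
  have hμ := connectiveConstant_pos d
  simp_rw [sum_memLoopCost]
  rw [Real.log_div (memGrowth_pos 2).ne' hμ.ne']
  have h2 : Tendsto (fun M : ℕ => 2 * M + 2) atTop atTop :=
    tendsto_atTop_atTop.2 fun b => ⟨b, fun a ha => by omega⟩
  exact tendsto_const_nhds.sub
    (((Real.continuousAt_log hμ.ne').tendsto).comp ((tendsto_memGrowth (d := d)).comp h2))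

/-- **Summability**: `Σ_{m ≥ 0} Δ_{2m+4}(d) = ln(μ_2(d)/μ(d))` — the rung costs of the whole hierarchy add up to the gap
between the non-reversing bound `μ_2` and the connective constant. [cite: MadrasSlade1993, §1.2, Lemma 1.2.3] -/
theorem hasSum_memLoopCost [NeZero d] :
    HasSum (fun m : ℕ => memLoopCost d (2 * m + 4)) (Real.log (memGrowth d 2 / connectiveConstant d)) :=
  (hasSum_iff_tendsto_nat_of_nonneg (fun _ => memLoopCost_nonneg _) _).2 tendsto_sum_memLoopCost

/-- **The link C1′ ↔ C4 (PROVED)**: the quantity of the typed memory-tail law C1′ at memory `2M+2` IS the tail sum of the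
rung costs of C4, `ln(μ_{2M+2}(d)/μ(d)) = Σ_{m ≥ 0} Δ_{2(m+M)+4}(d)`.  Hence C1′'s exponent statement `ln(μ_τ/μ) ≍ τ^{1−θ_d}`
is a statement about the DECAY OF THE TAIL SUMS of the `Δ_τ`, which C4 refines term by term. [cite: MadrasSlade1993, §1.2, Lemma 1.2.3] -/
theorem logRatio_eq_tsum_memLoopCost [NeZero d] (M : ℕ) :
    logRatio d (2 * M + 2) = ∑' m : ℕ, memLoopCost d (2 * (m + M) + 4) := by
  have hμ := connectiveConstant_pos d
  have hs := hasSum_memLoopCost (d := d)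
  have h1 := hs.summable.sum_add_tsum_nat_add M
  rw [hs.tsum_eq, sum_memLoopCost, Real.log_div (memGrowth_pos 2).ne' hμ.ne'] at h1
  unfold logRatio
  rw [Real.log_div (memGrowth_pos _).ne' hμ.ne']
  linarith

/-! ### Non-vacuity of the denominator: closing words -/

/-- **No odd polygons on the bipartite lattice**: `closingCount d (2k+1) = 0` for `k ≥ 1` (a `2k`-step word ends at even
`ℓ¹`-distance, so "within distance `0`" means back at the start, which self-avoidance forbids). [folklore] -/
theorem closingCount_odd (d k : ℕ) (hk : 1 ≤ k) : closingCount d (2 * k + 1) = 0 := by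
  classical
  unfold closingCount
  rw [show 2 * k + 1 - 1 = 2 * k by omega, nearWords_odd, Finset.card_eq_zero, Finset.eq_empty_iff_forall_notMem]
  intro w hw
  unfold nearWords at hw
  rw [Finset.mem_filter, mem_sawWords] at hw
  obtain ⟨hsaw, hl⟩ := hw
  have hl0 : l1 (wordPos w (2 * k)) = 0 := by omega
  have hpos : wordPos w (2 * k) = 0 := by
    funext i
    simp only [l1] at hl0
    exact Int.natAbs_eq_zero.1 (Finset.sum_eq_zero_iff.1 hl0 i (Finset.mem_univ _))
  have := hsaw (2 * k) 0 le_rfl (by omega) (by rw [hpos, wordPos_zero])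
  omega

/-- **Rectangles**: for `d ≥ 2` and `k ≥ 1` the `(2k+1)`-step word `e₀, e₁^k, −e₀, (−e₁)^{k−1}` (the `1 × k` rectangle opened at
its root) is self-avoiding and ends at `e₁`, within `ℓ¹`-distance `1` of the origin. [folklore] -/
theorem exists_closingWord (hd : 2 ≤ d) {k : ℕ} (hk : 1 ≤ k) :
    ∃ w : Fin (2 * k + 1) → Fin d × Bool, IsSAW w ∧ l1 (wordPos w (2 * k + 1)) ≤ 1 := by
  obtain ⟨d', rfl⟩ : ∃ d', d = d' + 2 := ⟨d - 2, by omega⟩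
  let e0 : Fin (d' + 2) := ⟨0, by omega⟩
  let e1 : Fin (d' + 2) := ⟨1, by omega⟩
  have hne : e0 ≠ e1 := by simp [e0, e1]
  let w : Fin (2 * k + 1) → Fin (d' + 2) × Bool := fun i =>
    if i.val = 0 then (e0, true) else if i.val ≤ k then (e1, true) else if i.val = k + 1 then (e0, false) else (e1, false)
  -- the two coordinates of the path after `t` steps
  let X : ℕ → ℤ := fun t => if 1 ≤ t ∧ t ≤ k + 1 then 1 else 0
  let Y : ℕ → ℤ := fun t => if t = 0 then 0 else if t ≤ k + 1 then (t : ℤ) - 1 else 2 * (k : ℤ) + 2 - t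
  let P : ℕ → Site (d' + 2) := fun t => Pi.single e0 (X t) + Pi.single e1 (Y t)
  have hP : ∀ t, t ≤ 2 * k + 1 → wordPos w t = P t := by
    intro t
    induction t with
    | zero => intro _; simp [P, X, Y]
    | succ t ih =>
      intro ht
      rw [wordPos_succ w (by omega : t < 2 * k + 1), ih (by omega)]
      -- which step is taken at time `t`
      rcases Nat.lt_or_ge t 1 with h0 | h1
      · have hw : w ⟨t, by omega⟩ = (e0, true) := by simp [w, show t = 0 by omega]
        have hX : X (t + 1) = X t + 1 := by simp only [X]; split_ifs <;> first | contradiction | omega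
        have hY : Y (t + 1) = Y t := by simp only [Y]; split_ifs <;> first | contradiction | omega
        rw [hw]; simp only [P, stepVec, if_true, hX, hY, Pi.single_add]; abel
      rcases Nat.lt_or_ge t (k + 1) with h2 | h2
      · have hw : w ⟨t, by omega⟩ = (e1, true) := by simp [w, show t ≠ 0 by omega, show t ≤ k by omega]
        have hX : X (t + 1) = X t := by simp only [X]; split_ifs <;> first | contradiction | omega
        have hY : Y (t + 1) = Y t + 1 := by simp only [Y]; split_ifs <;> first | contradiction | omega
        rw [hw]; simp only [P, stepVec, if_true, hX, hY, Pi.single_add]; abel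
      rcases Nat.lt_or_ge t (k + 2) with h3 | h3
      · have hw : w ⟨t, by omega⟩ = (e0, false) := by
          simp [w, show t = k + 1 by omega]
        have hX : X (t + 1) = X t - 1 := by simp only [X]; split_ifs <;> first | contradiction | omega
        have hY : Y (t + 1) = Y t := by simp only [Y]; split_ifs <;> first | contradiction | omega
        rw [hw]; simp only [P, stepVec, hX, hY, Pi.single_sub]; simp; abel
      · have hw : w ⟨t, by omega⟩ = (e1, false) := by
          simp [w, show t ≠ 0 by omega, show ¬ t ≤ k by omega, show t ≠ k + 1 by omega]
        have hX : X (t + 1) = X t := by simp only [X]; split_ifs <;> first | contradiction | omega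
        have hY : Y (t + 1) = Y t - 1 := by simp only [Y]; split_ifs <;> first | contradiction | omega
        rw [hw]; simp only [P, stepVec, hX, hY, Pi.single_sub]; simp; abel
  refine ⟨w, ?_, ?_⟩
  · intro i j hi hj hij
    rw [hP i hi, hP j hj] at hij
    have h0 := congrFun hij e0
    have h1 := congrFun hij e1
    simp only [P, Pi.add_apply, Pi.single_eq_same, Pi.single_eq_of_ne hne, Pi.single_eq_of_ne hne.symm,
      add_zero, zero_add] at h0 h1
    simp only [X, Y] at h0 h1
    split_ifs at h0 h1 <;> omega
  · have hend : wordPos w (2 * k + 1) = stepVec (e1, true) := by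
      rw [hP _ le_rfl]
      have hX : X (2 * k + 1) = 0 := by simp only [X]; split_ifs <;> first | contradiction | omega
      have hY : Y (2 * k + 1) = 1 := by simp only [Y]; split_ifs <;> first | contradiction | omega
      simp [P, hX, hY, stepVec]
    rw [hend, l1_stepVec]

/-- The unit square (`k = 1`): a 3-step self-avoiding word ending within `ℓ¹`-distance `1` of the origin (reused by the
site twin …PcintLoopExclusionSiteLaw). [folklore] -/
theorem exists_closingWord_three (hd : 2 ≤ d) :
    ∃ w : Fin 3 → Fin d × Bool, IsSAW w ∧ l1 (wordPos w 3) ≤ 1 :=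
  exists_closingWord hd (k := 1) le_rfl

/-- **`2τ p_τ(ℤ^d) > 0` for every even `τ = 2m ≥ 4` and `d ≥ 2`** (rectangles): the first-order densities `f_{2m}(d)` have
non-zero denominators at EVERY rung the typed conjecture speaks about, so clause (a) `0 < R_{2m}(d)` is not vacuously false
(`R = Δ/0 = 0` in Lean's conventions would refute it for a silly reason). [folklore] -/
theorem closingCount_even_pos (hd : 2 ≤ d) {m : ℕ} (hm : 2 ≤ m) : 0 < closingCount d (2 * m) := by
  classical
  obtain ⟨k, rfl⟩ : ∃ k, m = k + 1 := ⟨m - 1, by omega⟩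
  obtain ⟨w, hsaw, hl⟩ := exists_closingWord hd (k := k) (by omega)
  unfold closingCount
  rw [show 2 * (k + 1) - 1 = 2 * k + 1 by omega]
  refine Finset.card_pos.2 ⟨w, ?_⟩
  unfold nearWords
  rw [Finset.mem_filter, mem_sawWords]
  exact ⟨hsaw, by omega⟩

/-- `2·4·p_4(ℤ^d) > 0` for `d ≥ 2` (the unit square; the case `m = 2`). [folklore] -/
theorem closingCount_four_pos (hd : 2 ≤ d) : 0 < closingCount d 4 :=
  closingCount_even_pos hd (m := 2) le_rfl

/-- **`f_{2m}(d) > 0`** for `d ≥ 2`, `m ≥ 2`. [folklore] -/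
theorem memLoopDensity_even_pos [NeZero d] (hd : 2 ≤ d) {m : ℕ} (hm : 2 ≤ m) : 0 < memLoopDensity d (2 * m) :=
  memLoopDensity_pos (closingCount_even_pos hd hm)

/-! ### The typed conjecture C4 -/

/-- **C4 (a), the WINDOW `0 < R_τ(d) < 1`** for every `d ≥ 2` and even `τ = 2m ≥ 4`: the rung cost is STRICTLY positive (strict
monotonicity `μ_τ < μ_{τ−2}` of the memory hierarchy — open in the tree; a Kesten-pattern statement for finite-memory walks) and
STRICTLY below the independent-loop estimate (the loops newly forbidden at rung `τ` are positively correlated with the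
constraints already imposed).  Evidence: all 44 measured factors (d = 2..6, τ = 4..26) lie in [0.18, 0.85] (file docstring).
STRUCTURE CONJ C4 (prim-pcint-2 gen 15/16, 2026-08-23/24; STRUCTURE.md v0.6 §2; not kernel-checked). -/
@[conjecture] def loopCompatWindow : Prop :=
  ∀ d : ℕ, 2 ≤ d → ∀ m : ℕ, 2 ≤ m → 0 < loopCompat d (2 * m) ∧ loopCompat d (2 * m) < 1

/-- **C4 (b), MONOTONE IN THE DIMENSION**: `R_τ(d) < R_τ(d+1)` (loops and arms become mutually transparent as `d` grows;
`R → 1⁻` would be the mean-field reading).  Evidence: at every measured even τ = 4..12 the columns d = 2 < 3 < 4 < 5 < 6 are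
strictly ordered (e.g. τ = 12: 0.281 < 0.460 < 0.596 < 0.688 < 0.749); site twin: P15c (d-order of `R^N_τ`) pending/HIT lines in
STRUCTURE §3.  STRUCTURE CONJ C4 (prim-pcint-2 gen 15/16; not kernel-checked). -/
@[conjecture] def loopCompatStrictMonoDim : Prop :=
  ∀ d : ℕ, 2 ≤ d → ∀ m : ℕ, 2 ≤ m → loopCompat d (2 * m) < loopCompat (d + 1) (2 * m)

/-- **C4 (c), MONOTONE IN THE MEMORY**: `R_{τ+2}(d) < R_τ(d)` (longer loops are harder to fit between the arms).  Evidence: every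
measured column is strictly decreasing in τ (d = 2: 0.586 → 0.183 over τ = 4..26; d = 6: 0.848 → 0.749 over τ = 4..12); site
twin P15d (`d = 6` τ-order) pre-registered HIT.  STRUCTURE CONJ C4 (prim-pcint-2 gen 15/16; not kernel-checked). -/
@[conjecture] def loopCompatStrictAntiMemory : Prop :=
  ∀ d : ℕ, 2 ≤ d → ∀ m : ℕ, 2 ≤ m → loopCompat d (2 * m + 2) < loopCompat d (2 * m)

/-- **C4 (d), `d = 2`: `√τ · R_τ(2) → c₂ ∈ (0, ∞)`** (`α₂ = 1/2`; fit `√τ R_τ = 0.903 + 0.81/τ ± 0.0013` over τ = 10..26, nine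
rungs, OEIS A002931 polygon counts and the lane's `μ_τ(ℤ²)` to 10 digits; heuristic value `c₂ = κ₂ e^{κ₂}/B ≈ 0.90` with `κ₂` the
C1′ constant and `B` the polygon amplitude).  Pre-registered P13c (τ = 28) standing.  STRUCTURE CONJ C4 (prim-pcint-2 gen 15;
not kernel-checked). -/
@[conjecture] def loopCompatLawTwo : Prop :=
  ∃ c : ℝ, 0 < c ∧ Tendsto (fun m : ℕ => Real.sqrt (2 * m) * loopCompat 2 (2 * m)) atTop (𝓝 c)

/-- **C4 (d), `d = 3`: `τ^{a} · R_τ(3) → c₃ ∈ (0, ∞)` for some `a ∈ [0.15, 0.35]`** (hyperscaling reading `a = α₃ = 2 − 3ν₃ ≈ 0.237`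
with `ν₃ = 0.5876`; fit `τ^{0.237} R_τ = 0.751 + 0.92/τ ± 0.002` over τ = 10..18, five rungs, polygon counts Clisby–Liang–Slade).
STRUCTURE CONJ C4 (prim-pcint-2 gen 15; not kernel-checked). -/
@[conjecture] def loopCompatLawThree : Prop :=
  ∃ a : ℝ, a ∈ Set.Icc (0.15 : ℝ) 0.35 ∧ ∃ c : ℝ, 0 < c ∧
    Tendsto (fun m : ℕ => (2 * (m : ℝ)) ^ a * loopCompat 3 (2 * m)) atTop (𝓝 c)

/-- **C4 (d), `d = 4` (marginal, `α₄ = 0`): `R_τ(4)` is SLOWLY VARYING** — for every `ε > 0`, `τ^{−ε} R_τ(4) → 0` and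
`τ^{ε} R_τ(4) → ∞` (logarithmic corrections only; the term-by-term form of C1′'s `lawFour`).  Evidence (weakest clause): R_τ(4) =
0.780 … 0.567 over τ = 4..16 with local exponent 0.17 at τ = 16 and falling.  STRUCTURE CONJ C4 (prim-pcint-2 gen 15/16; not
kernel-checked). -/
@[conjecture] def loopCompatLawFour : Prop :=
  ∀ ε : ℝ, 0 < ε →
    Tendsto (fun m : ℕ => (2 * (m : ℝ)) ^ (-ε) * loopCompat 4 (2 * m)) atTop (𝓝 0) ∧
    Tendsto (fun m : ℕ => (2 * (m : ℝ)) ^ ε * loopCompat 4 (2 * m)) atTop atTop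

/-- **C4 (d), `d ≥ 5` (above the upper critical dimension, `α_d < 0`): `R_τ(d) → ρ_d ∈ (0, 1)`** — the compatibility cost per
loop stays `O(1)` and does not vanish (Gaussian, mutually transparent blobs), so `Δ_τ ≍ f_τ ≍ τ^{−d/2}` = C1′'s `lawHigh`.
Evidence: d = 5: 0.702 / 0.688 / 0.679 (τ = 10/12/14), d = 6: 0.757 / 0.749 (τ = 10/12), local exponents 0.09 / 0.06 and falling;
pre-registered P13a/P13b (`R_16(5) = 0.6710`, `R_16(6) = 0.7402`, `R_14(6) = 0.7440` inside bands of half-width ≤ 0.007) HIT ×3.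
STRUCTURE CONJ C4 (prim-pcint-2 gen 15/16; not kernel-checked). -/
@[conjecture] def loopCompatLawHigh : Prop :=
  ∀ d : ℕ, 5 ≤ d → ∃ ρ : ℝ, 0 < ρ ∧ ρ < 1 ∧ Tendsto (fun m : ℕ => loopCompat d (2 * m)) atTop (𝓝 ρ)

/-- Bookkeeping between the clauses (no mathematics beyond the proved sanity facts): clause (a) at a rung forces the closing
count there to be non-zero, i.e. the typed window is a statement about rungs that carry polygons. [folklore] -/
theorem closingCount_pos_of_loopCompat_pos [NeZero d] {τ : ℕ} (h : 0 < loopCompat d τ) : 0 < closingCount d τ := by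
  by_contra h0
  have h0' : closingCount d τ = 0 := by omega
  have : loopCompat d τ = 0 := by simp [loopCompat, memLoopDensity, h0']
  exact h.ne' this

end Summit.CriticalPhenomena.PercolationContinuityZ3.Theorems.Pcint.MemoryTail
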